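import Literature.MathematicalPhysics.QuantumFieldTheory.Balaban1983to89.T3UnitScaleTilt
import HarnessLib

/-!
# `Balaban1983to89.T3RestrictedUnitDensity` — rung R3, crux K1 IN BAŁABAN'S DENSITY CURRENCY: the RESTRICTED renormalised
# densities `ρ^S_k = T_{k−1}⋯T_0(1_S·e^{−β_K A})` of the d = 3 approximations at the printed smearing are CONSTRUCTED, the
# unit-lattice push-forward of the Gibbs measure restricted to any measurable event `S` IS `Z_K⁻¹ρ̂^S_K · dV_{T₁}`, and the route's
# measure-level K1 at step `K` FOLLOWS from a two-run sandwich, modulo a constant, of the restricted unit densities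

Cell `ym3-torus` (HUMAN RULING D-0037, YM ladder rung R3), seat `ym3-torus-p2` gen 3.  WHAT THIS IS NOT: not d = 4, not infinite
volume, not a mass gap, not Clay, and NOT K1: no bound of [Balaban1985UV3] on the restricted densities is asserted — the two-run
sandwich is the HYPOTHESIS of §3 (it is the d = 3 expectations step; [Balaban1985UV3] (41)/(47) print ONE-run envelopes of exactly
these objects, `χ_k exp(−g_k⁻²A(U_k) + Σ𝒫_j + R) ≤ ρ_k`, never a comparison of two runs; the abelian template is [King1986] Thm 3.4).

WHY THIS FILE.  The route `UnitScaleTilt` (HOME/route-R3) types its rank-2 crux K1 at the level of MEASURES: the unit-lattice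
push-forwards of the Gibbs measures of run `K+1` and run `K`, each restricted to Bałaban's UV-small-history event, are tilts of
each other (`T3UnitScaleTilt.IsTilt`, `UnitTiltAt`).  The (α)/UV3 programme of the tree (`Balaban1985CMP102.SectB.TowerObjects.rhoRes`,
`Summits.QuantumFields.Balaban3D`) speaks about DENSITIES: the small-field-history part `T^k(χ·ρ₀)` of the effective density.
This file identifies the two: (§1) the Radon–Nikodym tower `towerDensity F K ρ₀ k = T_{k−1}⋯T_0 ρ₀` from an ARBITRARY initial
density on the finest lattice of the `K`-th approximation (the tree's `T3UnitLawDensityEML.emlDensity` is the case `ρ₀ = e^{−β_K A}`,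
`emlDensity_eq_towerDensity`), with positivity, measurability, integrability and the push-forward identity
`∫ (T^kρ₀) f dV_k = ∫ ρ₀ · (f ∘ avg^k) dU` ([Balaban1985Averaging] (10), [Balaban1985UV3] (2)/(6)); (§2) the RESTRICTED densities
`resDensity F γ K S k := towerDensity (1_S · e^{−β_K A}) k` and their unit-label reading `resUnitDensity` (`ρ̂^S_K`), with
**`map_unitA_restrict_eq_withDensity`**: `(A_K)_*(Gibbs_K|S) = dV_{T₁}.withDensity (Z_K⁻¹ ρ̂^S_K)` — hypothesis-free (`SU(2)`,
printed smearing, `γ ≥ 0`, `S` measurable), and `resUnitDensity_univ : ρ̂^{univ}_K = ρ̂_K`; (§3) **`isTilt_restrict_of_sandwich`**: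
a pointwise (or almost-everywhere, `isTilt_restrict_of_sandwich_ae`) sandwich `e^{−r}·c·ρ̂^{S₀}_{K} ≤ ρ̂^{S₁}_{K+1} ≤ e^{r}·c·ρ̂^{S₀}_K`
with a FREE constant `c > 0` (partition functions and vacuum energies need not be matched) ⇒ the route's per-`K` tilt
`IsTilt ((A_K)_*(Gibbs_K|S₀)) ((A_{K+1})_*(Gibbs_{K+1}|S₁)) r`, and **`unitTiltAt_of_sandwich`**: summable radii ⇒ `UnitTiltAt F γ b₀ p₀ m`
— K1 of the route in the currency in which the (α) inputs are typed.
-/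

noncomputable section

open MeasureTheory Filter Topology
open Literature.MathematicalPhysics.QuantumFieldTheory.Balaban1983to89.T3ContinuumYM3Torus
open Literature.MathematicalPhysics.QuantumFieldTheory.Balaban1983to89.T3LevelShift
open Literature.MathematicalPhysics.QuantumFieldTheory.Balaban1983to89.T3ThresholdRemoval
open Literature.MathematicalPhysics.QuantumFieldTheory.Balaban1983to89.T3UnitLawDensityEML
open Literature.MathematicalPhysics.QuantumFieldTheory.Balaban1983to89.T3UnitScaleTilt
open Literature.MathematicalPhysics.QuantumFieldTheory.Balaban1983to89.Missing
open Literature.MathematicalPhysics.QuantumFieldTheory.Balaban1983to89.T4Continuum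

namespace Literature.MathematicalPhysics.QuantumFieldTheory.Balaban1983to89.T3RestrictedUnitDensity

/-! ## §0 The almost-everywhere density adapter -/

section AE

variable {X : Type*} [MeasurableSpace X]

/-- **THE DENSITY ADAPTER, ALMOST-EVERYWHERE FORM**: an a.e. two-sided sandwich MODULO A CONSTANT `e^{−r}·c·ρ₀ ≤ ρ₁ ≤ e^{r}·c·ρ₀`
of two non-negative measurable densities for one reference measure makes `ρ₁λ` a tilt of `ρ₀λ` of radius `r` (the log-density is
clipped to `[−r, r]`, which changes nothing off the exceptional null set).  Needed because Radon–Nikodym densities are versions.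
[cite: Balaban1985UV3, (41) p.266 and (47) p.267] -/
theorem isTilt_withDensity_of_sandwich_ae (lam : Measure X) {ρ₀ ρ₁ : X → ℝ} (hm₀ : Measurable ρ₀) (hm₁ : Measurable ρ₁)
    (h₀ : ∀ x, 0 ≤ ρ₀ x) (h₁ : ∀ x, 0 ≤ ρ₁ x) {r c : ℝ} (hr : 0 ≤ r) (hc : 0 < c)
    (hs : ∀ᵐ x ∂lam, Real.exp (-r) * c * ρ₀ x ≤ ρ₁ x ∧ ρ₁ x ≤ Real.exp r * c * ρ₀ x) :
    IsTilt (lam.withDensity fun x => ENNReal.ofReal (ρ₀ x)) (lam.withDensity fun x => ENNReal.ofReal (ρ₁ x)) r := by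
  classical
  -- the clipped log-density
  let raw : X → ℝ := fun x => if 0 < ρ₀ x then Real.log (ρ₁ x / (c * ρ₀ x)) else 0
  let h : X → ℝ := fun x => max (-r) (min r (raw x))
  have hrawm : Measurable raw :=
    Measurable.ite (measurableSet_lt measurable_const hm₀) ((hm₁.div (hm₀.const_mul c)).log) measurable_const
  have hhm : Measurable h := measurable_const.max (measurable_const.min hrawm)
  have hh : ∀ x, |h x| ≤ r := fun x =>
    abs_le.mpr ⟨le_max_left _ _, max_le (by linarith) (min_le_left _ _)⟩
  -- on the good set the clipping is invisible and the density identity holds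
  have hgood : ∀ x, (Real.exp (-r) * c * ρ₀ x ≤ ρ₁ x ∧ ρ₁ x ≤ Real.exp r * c * ρ₀ x) →
      ENNReal.ofReal (ρ₁ x) = ENNReal.ofReal (ρ₀ x) * ENNReal.ofReal (c * Real.exp (h x)) := by
    intro x hx
    rw [← ENNReal.ofReal_mul (h₀ x)]
    congr 1
    by_cases hp : 0 < ρ₀ x
    · have hcx : 0 < c * ρ₀ x := mul_pos hc hp
      have h1 : Real.exp (-r) ≤ ρ₁ x / (c * ρ₀ x) := by rw [le_div_iff₀ hcx]; linarith [hx.1]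
      have h2 : ρ₁ x / (c * ρ₀ x) ≤ Real.exp r := by rw [div_le_iff₀ hcx]; linarith [hx.2]
      have hq : 0 < ρ₁ x / (c * ρ₀ x) := lt_of_lt_of_le (Real.exp_pos _) h1
      have hraw : raw x = Real.log (ρ₁ x / (c * ρ₀ x)) := if_pos hp
      have hlo : -r ≤ raw x := by
        rw [hraw]; have := Real.log_le_log (Real.exp_pos _) h1; rwa [Real.log_exp] at this
      have hhi : raw x ≤ r := by
        rw [hraw]; have := Real.log_le_log hq h2; rwa [Real.log_exp] at this
      have hhx : h x = raw x := by
        show max (-r) (min r (raw x)) = raw x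
        rw [min_eq_right hhi, max_eq_right hlo]
      rw [hhx, hraw, Real.exp_log hq]
      field_simp
    · have e0 : ρ₀ x = 0 := le_antisymm (not_lt.mp hp) (h₀ x)
      have e1 : ρ₁ x = 0 := by
        refine le_antisymm ?_ (h₁ x)
        have := hx.2; rw [e0, mul_zero] at this; exact this
      rw [e0, e1, zero_mul]
  refine ⟨hr, h, c, hhm, hc.le, hh, ?_⟩
  have hdm : Measurable fun x => ENNReal.ofReal (c * Real.exp (h x)) :=
    ((Real.measurable_exp.comp hhm).const_mul c).ennreal_ofReal
  rw [← withDensity_mul _ hm₀.ennreal_ofReal hdm]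
  exact withDensity_congr_ae (hs.mono fun x hx => hgood x hx)

end AE

/-! ## §1 Radon–Nikodym towers from an arbitrary initial density (printed smearing, `SU(2)`) -/

section Tower

variable (F : T3Family) (K : ℕ) (ρ₀ : Density (F.P K) 0 (Matrix.specialUnitaryGroup (Fin 2) ℂ))

/-- **THE RENORMALISED TOWER FROM AN ARBITRARY INITIAL DENSITY**: `ρ^{ρ₀}_0 = ρ₀`, `ρ^{ρ₀}_{k+1} = T_k ρ^{ρ₀}_k` with `T_k` the
Radon–Nikodym transport over the (0.4) averaging at the printed smearing (tree `T3UnitLawDensityEML.rt`), for `k + 1 ≤ m + K`;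
`0` beyond the standing range (never used).  [Balaban1985UV3] (2) `ρ_{k+1} = Tρ_k` with a general `ρ₀` (e.g. `χ·e^{−βA}`, the
small-field term of the decomposition (7)). [cite: Balaban1985UV3, (2) p.256 and (7) p.257] -/
def towerDensity : (k : ℕ) → Density (F.P K) k (Matrix.specialUnitaryGroup (Fin 2) ℂ)
  | 0 => ρ₀
  | k + 1 => if h : k + 1 ≤ F.m + K then (rt F K k h).T (towerDensity k) else fun _ => 0

/-- `ρ^{ρ₀}_0 = ρ₀`. [cite: Balaban1985UV3, (2) p.256] -/
theorem towerDensity_zero : towerDensity F K ρ₀ 0 = ρ₀ := rfl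

/-- `ρ^{ρ₀}_{k+1} = T_k ρ^{ρ₀}_k` in the standing range. [cite: Balaban1985UV3, (2) p.256] -/
theorem towerDensity_succ {k : ℕ} (h : k + 1 ≤ F.m + K) :
    towerDensity F K ρ₀ (k + 1) = (rt F K k h).T (towerDensity F K ρ₀ k) := by
  simp only [towerDensity, dif_pos h]

variable {ρ₀}

/-- `ρ^{ρ₀}_k ≥ 0` for `ρ₀ ≥ 0` (`RTOpI.pos`). [cite: Balaban1985UV3, (2) p.256] -/
theorem towerDensity_nonneg (h0 : ∀ U, 0 ≤ ρ₀ U) :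
    ∀ (k : ℕ) (V : GaugeField (F.P K) k (Matrix.specialUnitaryGroup (Fin 2) ℂ)), 0 ≤ towerDensity F K ρ₀ k V
  | 0, V => h0 V
  | k + 1, V => by
    by_cases h : k + 1 ≤ F.m + K
    · rw [towerDensity_succ F K ρ₀ h]
      exact (rt F K k h).pos _ (towerDensity_nonneg h0 k) V
    · rw [towerDensity, dif_neg h]

/-- `ρ^{ρ₀}_k` is measurable for `ρ₀ ≥ 0` measurable (Radon–Nikodym derivatives are). [cite: Balaban1985UV3, (2) p.256] -/
theorem measurable_towerDensity (h0 : ∀ U, 0 ≤ ρ₀ U) (hm : Measurable ρ₀) : ∀ k : ℕ, Measurable (towerDensity F K ρ₀ k)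
  | 0 => hm
  | k + 1 => by
    by_cases h : k + 1 ≤ F.m + K
    · rw [towerDensity_succ F K ρ₀ h]
      show Measurable (AveragingRT.rnTransport (BlockAveraging.blockAvg (P := F.P K) (j := k) ℰp).avg (towerDensity F K ρ₀ k))
      have hk0 := towerDensity_nonneg F K h0 k
      have heq : AveragingRT.rnTransport (BlockAveraging.blockAvg (P := F.P K) (j := k) ℰp).avg (towerDensity F K ρ₀ k) =
          AveragingRT.rnDensity (BlockAveraging.blockAvg (P := F.P K) (j := k) ℰp).avg (towerDensity F K ρ₀ k) := by
        funext V
        simp only [AveragingRT.rnTransport, if_pos hk0]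
      rw [heq]
      exact (Measure.measurable_rnDeriv _ _).ennreal_toReal
    · rw [towerDensity, dif_neg h]
      exact measurable_const

/-- `ρ^{ρ₀}_k` is integrable in the standing range for `ρ₀` integrable (`T4FiniteEpsInhabited.integrable_rnTransport_of_ac`).
[cite: Balaban1985UV3, (6) p.257] -/
theorem integrable_towerDensity
    (hi : Integrable ρ₀ (fieldMeasure (F.P K) 0 (Matrix.specialUnitaryGroup (Fin 2) ℂ))) : ∀ k : ℕ, k ≤ F.m + K →
    Integrable (towerDensity F K ρ₀ k) (fieldMeasure (F.P K) k (Matrix.specialUnitaryGroup (Fin 2) ℂ))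
  | 0, _ => hi
  | k + 1, hk => by
    rw [towerDensity_succ F K ρ₀ hk]
    exact T4FiniteEpsInhabited.integrable_rnTransport_of_ac _ (measurable_blockAvg F K k) (haarAC_blockAvg F K hk) _
      (integrable_towerDensity hi k (by omega))

/-- **THE PUSH-FORWARD IDENTITY WITH A TEST FUNCTION**: `∫ ρ^{ρ₀}_k(V)·f(V) dV_k = ∫ ρ₀(U)·f(Ū^k) dU` for bounded measurable `f`,
`k ≤ m + K` ([Balaban1985Averaging] (10) iterated; [Balaban1985UV3] (2)/(6)). [cite: Balaban1985Averaging, (10) p.19] -/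
theorem integral_towerDensity_mul
    (hi : Integrable ρ₀ (fieldMeasure (F.P K) 0 (Matrix.specialUnitaryGroup (Fin 2) ℂ))) : ∀ (k : ℕ), k ≤ F.m + K →
    ∀ (f : GaugeField (F.P K) k (Matrix.specialUnitaryGroup (Fin 2) ℂ) → ℝ), Measurable f → (∃ C : ℝ, ∀ V, |f V| ≤ C) →
      ∫ V, towerDensity F K ρ₀ k V * f V ∂fieldMeasure (F.P K) k (Matrix.specialUnitaryGroup (Fin 2) ℂ) =
        ∫ U, ρ₀ U * f (Averaging.iter (fun j => BlockAveraging.blockAvg (P := F.P K) (j := j) ℰp) k U)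
          ∂fieldMeasure (F.P K) 0 (Matrix.specialUnitaryGroup (Fin 2) ℂ)
  | 0, _, _, _, _ => rfl
  | k + 1, hk, f, hf, hC => by
    obtain ⟨C, hC⟩ := hC
    rw [towerDensity_succ F K ρ₀ hk]
    have step := (rt F K k hk).isRT _ (integrable_towerDensity F K hi k (by omega)) f hf ⟨C, hC⟩
    rw [step]
    exact integral_towerDensity_mul hi k (by omega)
      (fun U => f ((BlockAveraging.blockAvg (P := F.P K) (j := k) ℰp).avg U))
      (hf.comp (measurable_blockAvg F K k)) ⟨C, fun U => hC _⟩

/-- The tree's `emlDensity` is the tower from the Boltzmann weight (`ρ₀ = e^{−β_K A}`). [cite: Balaban1985UV3, (1)-(2) p.256] -/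
theorem emlDensity_eq_towerDensity (γ : ℝ) :
    ∀ k : ℕ, emlDensity F γ K k = towerDensity F K (boltzmann (F.P K) ((F.scheme ℰp γ).β K)) k
  | 0 => rfl
  | k + 1 => by
    by_cases h : k + 1 ≤ F.m + K
    · rw [emlDensity_succ F γ K h, towerDensity_succ F K _ h, emlDensity_eq_towerDensity γ k]
    · rw [emlDensity, dif_neg h, towerDensity, dif_neg h]

end Tower

/-! ## §2 The restricted densities and the push-forward of the restricted Gibbs measure -/

section Restricted

variable (F : T3Family) (γ : ℝ) (K : ℕ) (S : Set (GaugeField (F.P K) 0 (Matrix.specialUnitaryGroup (Fin 2) ℂ)))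

/-- **BAŁABAN'S RESTRICTED RENORMALISED DENSITIES** `ρ^S_k := T_{k−1}⋯T_0 (1_S · e^{−β_K A})` of the `K`-th approximation: the part
of `ρ_k` coming from the fine configurations in the event `S` (for `S` = a small-field history, the small-field term of the
decomposition (7), whose envelope is (41)/(47)). [cite: Balaban1985UV3, (7) p.257 and (41) p.266] -/
def resDensity : (k : ℕ) → Density (F.P K) k (Matrix.specialUnitaryGroup (Fin 2) ℂ) :=
  towerDensity F K (S.indicator (boltzmann (F.P K) ((F.scheme ℰp γ).β K)))

/-- `1_S·e^{−βA} ≥ 0`. [cite: Balaban1985UV3, (1) p.256] -/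
theorem indicator_boltzmann_nonneg (U : GaugeField (F.P K) 0 (Matrix.specialUnitaryGroup (Fin 2) ℂ)) :
    0 ≤ S.indicator (boltzmann (F.P K) ((F.scheme ℰp γ).β K)) U :=
  Set.indicator_nonneg (fun V _ => (boltzmann_pos _ _ V).le) U

/-- `ρ^S_k ≥ 0`. [cite: Balaban1985UV3, (2) p.256] -/
theorem resDensity_nonneg (k : ℕ) (V : GaugeField (F.P K) k (Matrix.specialUnitaryGroup (Fin 2) ℂ)) :
    0 ≤ resDensity F γ K S k V :=
  towerDensity_nonneg F K (indicator_boltzmann_nonneg F γ K S) k V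

variable {S}

/-- `ρ^S_k` is measurable (`S` measurable). [cite: Balaban1985UV3, (2) p.256] -/
theorem measurable_resDensity (hS : MeasurableSet S) (k : ℕ) : Measurable (resDensity F γ K S k) :=
  measurable_towerDensity F K (indicator_boltzmann_nonneg F γ K S)
    ((measurable_boltzmann RegularGaugeGroup.measurable_reTr _ _).indicator hS) k

variable {γ}

/-- `ρ^S_k` is integrable in the standing range (`γ ≥ 0`, `S` measurable). [cite: Balaban1985UV3, (6) p.257] -/
theorem integrable_resDensity (hS : MeasurableSet S) (hγ : 0 ≤ γ) {k : ℕ} (hk : k ≤ F.m + K) :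
    Integrable (resDensity F γ K S k) (fieldMeasure (F.P K) k (Matrix.specialUnitaryGroup (Fin 2) ℂ)) :=
  integrable_towerDensity F K
    ((integrable_boltzmann RegularGaugeGroup.measurable_reTr _ (F.scheme_β_nonneg ℰp hγ K)).indicator hS) k hk

/-- **(2)/(6) WITH A TEST FUNCTION FOR THE RESTRICTED DENSITIES**: `∫ ρ^S_k(V)·f(V) dV_k = ∫_S e^{−β_K A(U)}·f(Ū^k) dU`.
[cite: Balaban1985UV3, (2) p.256 + (6) p.257] -/
theorem integral_resDensity_mul (hS : MeasurableSet S) (hγ : 0 ≤ γ) {k : ℕ} (hk : k ≤ F.m + K)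
    (f : GaugeField (F.P K) k (Matrix.specialUnitaryGroup (Fin 2) ℂ) → ℝ) (hf : Measurable f) (hC : ∃ C : ℝ, ∀ V, |f V| ≤ C) :
    ∫ V, resDensity F γ K S k V * f V ∂fieldMeasure (F.P K) k (Matrix.specialUnitaryGroup (Fin 2) ℂ) =
      ∫ U, S.indicator (boltzmann (F.P K) ((F.scheme ℰp γ).β K)) U *
        f (Averaging.iter (fun j => BlockAveraging.blockAvg (P := F.P K) (j := j) ℰp) k U)
          ∂fieldMeasure (F.P K) 0 (Matrix.specialUnitaryGroup (Fin 2) ℂ) :=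
  integral_towerDensity_mul F K
    ((integrable_boltzmann RegularGaugeGroup.measurable_reTr _ (F.scheme_β_nonneg ℰp hγ K)).indicator hS) k hk f hf hC

variable (γ S)

/-- **THE RESTRICTED DENSITY READ ON THE UNIT LABELS**: `ρ̂^S_K(u) := ρ^S_K(unitShift⁻¹ u)` (unnormalised). [cite: Balaban1985UV3, (2) p.256] -/
def resUnitDensity (u : GaugeField (F.P 0) 0 (Matrix.specialUnitaryGroup (Fin 2) ℂ)) : ℝ :=
  resDensity F γ K S K (fieldShift (F.sitesPerDir_unit K).symm u)

/-- `ρ̂^S_K(unitShift V) = ρ^S_K(V)`. [cite: Balaban1985UV3, (2) p.256] -/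
theorem resUnitDensity_unitShift (V : GaugeField (F.P K) K (Matrix.specialUnitaryGroup (Fin 2) ℂ)) :
    resUnitDensity F γ K S (unitShift F K V) = resDensity F γ K S K V := by
  unfold resUnitDensity
  rw [unitShift_eq, fieldShift_fieldShift_symm]

/-- `ρ̂^S_K ≥ 0`. [cite: Balaban1985UV3, (2) p.256] -/
theorem resUnitDensity_nonneg (u : GaugeField (F.P 0) 0 (Matrix.specialUnitaryGroup (Fin 2) ℂ)) :
    0 ≤ resUnitDensity F γ K S u :=
  resDensity_nonneg F γ K S K _

variable {γ S}

/-- `ρ̂^S_K` is measurable and integrable for product Haar on `T₁` (`γ ≥ 0`, `S` measurable). [cite: Balaban1985UV3, (6) p.257] -/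
theorem resUnitDensity_props (hS : MeasurableSet S) (hγ : 0 ≤ γ) :
    Measurable (resUnitDensity F γ K S) ∧
      Integrable (resUnitDensity F γ K S) (fieldMeasure (F.P 0) 0 (Matrix.specialUnitaryGroup (Fin 2) ℂ)) :=
  ⟨(measurable_resDensity F γ K hS K).comp (measurable_fieldShift _),
    (measurePreserving_fieldShift (F.sitesPerDir_unit K).symm).integrable_comp_of_integrable
      (integrable_resDensity F K hS hγ (Nat.le_add_left K F.m))⟩

/-- With `S = univ` the restricted density is the tree's `unitDensity` (`ρ̂_K`). [cite: Balaban1985UV3, (2) p.256] -/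
theorem resUnitDensity_univ (u : GaugeField (F.P 0) 0 (Matrix.specialUnitaryGroup (Fin 2) ℂ)) :
    resUnitDensity F γ K Set.univ u = unitDensity F γ K u := by
  unfold resUnitDensity unitDensity resDensity
  rw [Set.indicator_univ, emlDensity_eq_towerDensity]

/-- **INTEGRATION AGAINST THE PUSHED-FORWARD RESTRICTED GIBBS MEASURE**: for bounded measurable `f` on unit fields,
`∫ f d((A_K)_*(Gibbs_K|S)) = (∫ ρ^S_K(V)·f(unitShift V) dV_K)/Z_K`. [cite: Balaban1985UV3, (2) p.256 + (6) p.257] -/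
theorem integral_map_unitA_restrict (hS : MeasurableSet S) (hγ : 0 ≤ γ)
    (f : GaugeField (F.P 0) 0 (Matrix.specialUnitaryGroup (Fin 2) ℂ) → ℝ) (hf : Measurable f) (hC : ∃ C : ℝ, ∀ u, |f u| ≤ C) :
    ∫ u, f u ∂Measure.map (unitA F ℰp K) ((gibbsK F ℰp γ K).restrict S) =
      (∫ V, resDensity F γ K S K V * f (unitShift F K V) ∂fieldMeasure (F.P K) K (Matrix.specialUnitaryGroup (Fin 2) ℂ)) /
        partitionFn (G := Matrix.specialUnitaryGroup (Fin 2) ℂ) (F.P K) ((F.scheme ℰp γ).β K) := by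
  obtain ⟨C, hC⟩ := hC
  rw [integral_map (measurable_unitA F ℰp measurableE_ℰp K).aemeasurable hf.aestronglyMeasurable,
    ← integral_indicator hS, gibbsK_eq, T4GenFunBounds.integral_gibbsMeasure _ (F.scheme_β_nonneg ℰp hγ K),
    integral_resDensity_mul F K hS hγ (Nat.le_add_left K F.m) (fun V => f (unitShift F K V))
      (hf.comp (measurable_unitShift F K)) ⟨C, fun V => hC _⟩]
  congr 1
  refine integral_congr_ae (Eventually.of_forall fun U => ?_)
  show S.indicator (fun U => f (unitA F ℰp K U)) U * boltzmann (F.P K) ((F.scheme ℰp γ).β K) U =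
    S.indicator (boltzmann (F.P K) ((F.scheme ℰp γ).β K)) U * f (unitA F ℰp K U)
  by_cases hU : U ∈ S
  · rw [Set.indicator_of_mem hU, Set.indicator_of_mem hU, mul_comm]
  · rw [Set.indicator_of_notMem hU, Set.indicator_of_notMem hU, zero_mul, zero_mul]

/-- Two finite measures with equal integrals of all measurable `f`, `|f| ≤ 1`, are equal (local helper). [folklore] -/
private theorem ext_of_forall_integral_eq {X : Type*} [MeasurableSpace X] {μ ν : Measure X} [IsFiniteMeasure μ]
    [IsFiniteMeasure ν] (h : ∀ f : X → ℝ, Measurable f → (∀ x, |f x| ≤ 1) → ∫ x, f x ∂μ = ∫ x, f x ∂ν) : μ = ν := by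
  refine Measure.ext fun s hs => ?_
  have hb : ∀ y, |s.indicator (1 : X → ℝ) y| ≤ 1 := fun y => by
    by_cases hy : y ∈ s
    · simp [hy]
    · simp [hy]
  have h1 := h _ (measurable_one.indicator hs) hb
  rw [integral_indicator_one hs, integral_indicator_one hs] at h1
  exact (ENNReal.toReal_eq_toReal_iff' (measure_ne_top _ _) (measure_ne_top _ _)).mp h1

/-- **THE PUSH-FORWARD OF THE RESTRICTED GIBBS MEASURE HAS THE DENSITY `Z_K⁻¹ρ̂^S_K` WITH RESPECT TO PRODUCT HAAR ON `T₁`** —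
hypothesis-free at the printed smearing on `SU(2)` (`γ ≥ 0`, `S` measurable):
`(A_K)_*(Gibbs_K|S) = dV_{T₁}.withDensity (Z_K⁻¹ρ̂^S_K)`.  The two measures compared by the route's K1 are of this form.
[cite: Balaban1985UV3, (2) p.256 + (6) p.257] -/
theorem map_unitA_restrict_eq_withDensity (hS : MeasurableSet S) (hγ : 0 ≤ γ) :
    Measure.map (unitA F ℰp K) ((gibbsK F ℰp γ K).restrict S) =
      (fieldMeasure (F.P 0) 0 (Matrix.specialUnitaryGroup (Fin 2) ℂ)).withDensity (fun u => ENNReal.ofReal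
        ((partitionFn (G := Matrix.specialUnitaryGroup (Fin 2) ℂ) (F.P K) ((F.scheme ℰp γ).β K))⁻¹ *
          resUnitDensity F γ K S u)) := by
  obtain ⟨hdm, hdi⟩ := resUnitDensity_props F K hS hγ
  have hd0 := resUnitDensity_nonneg F γ K S
  have hZ : 0 < partitionFn (G := Matrix.specialUnitaryGroup (Fin 2) ℂ) (F.P K) ((F.scheme ℰp γ).β K) :=
    partitionFn_pos' _ (F.scheme_β_nonneg ℰp hγ K)
  set Z := partitionFn (G := Matrix.specialUnitaryGroup (Fin 2) ℂ) (F.P K) ((F.scheme ℰp γ).β K) with hZdef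
  have hm : Measurable fun u => Z⁻¹ * resUnitDensity F γ K S u := hdm.const_mul _
  have h0 : ∀ u, 0 ≤ Z⁻¹ * resUnitDensity F γ K S u := fun u => mul_nonneg (inv_nonneg.mpr hZ.le) (hd0 u)
  haveI := isProbabilityMeasure_gibbsK F ℰp hγ K
  haveI : IsFiniteMeasure ((fieldMeasure (F.P 0) 0 (Matrix.specialUnitaryGroup (Fin 2) ℂ)).withDensity
      fun u => ENNReal.ofReal (Z⁻¹ * resUnitDensity F γ K S u)) :=
    isFiniteMeasure_withDensity_ofReal (hdi.const_mul _).2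
  refine ext_of_forall_integral_eq fun f hf hb => ?_
  rw [integral_map_unitA_restrict F K hS hγ f hf ⟨1, hb⟩, T4VarianceMatching.integral_withDensity_ofReal_mul hm h0 f]
  have hcv : ∫ u, Z⁻¹ * resUnitDensity F γ K S u * f u ∂fieldMeasure (F.P 0) 0 (Matrix.specialUnitaryGroup (Fin 2) ℂ) =
      ∫ V, Z⁻¹ * resUnitDensity F γ K S (unitShift F K V) * f (unitShift F K V)
        ∂fieldMeasure (F.P K) K (Matrix.specialUnitaryGroup (Fin 2) ℂ) :=
    (integral_comp_fieldShift (F.sitesPerDir_unit K) (fun u => Z⁻¹ * resUnitDensity F γ K S u * f u)).symm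
  rw [hcv]
  simp_rw [resUnitDensity_unitShift]
  rw [← integral_div]
  refine integral_congr_ae (Eventually.of_forall fun V => ?_)
  ring

end Restricted

/-! ## §3 K1 in the density currency: the route's tilt from a two-run sandwich of restricted unit densities -/

section Sandwich

variable (F : T3Family) {γ : ℝ} (hγ : 0 ≤ γ) (K : ℕ)
  {S₀ : Set (GaugeField (F.P K) 0 (Matrix.specialUnitaryGroup (Fin 2) ℂ))}
  {S₁ : Set (GaugeField (F.P (K + 1)) 0 (Matrix.specialUnitaryGroup (Fin 2) ℂ))}

include hγ

/-- **K1 AT STEP `K` ⇐ THE TWO-RUN SANDWICH OF RESTRICTED UNIT DENSITIES, MODULO A CONSTANT**: if for some FREE `c > 0` and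
`r ≥ 0` the restricted unit densities of run `K+1` (event `S₁`) and run `K` (event `S₀`) satisfy
`e^{−r}·c·ρ̂^{S₀}_K ≤ ρ̂^{S₁}_{K+1} ≤ e^{r}·c·ρ̂^{S₀}_K` pointwise on the unit-field space, then the unit-lattice push-forward of
`Gibbs_{K+1}|S₁` is a tilt of radius `r` of that of `Gibbs_K|S₀` (the partition functions go into the constant).  UNNORMALISED
densities: no matching of `Z_K`, `Z_{K+1}` or of vacuum energies is asked. [cite: King1986, Thm 3.4 (3.9) p.656] -/
theorem isTilt_restrict_of_sandwich (hS₀ : MeasurableSet S₀) (hS₁ : MeasurableSet S₁) {r c : ℝ} (hr : 0 ≤ r) (hc : 0 < c)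
    (hsand : ∀ u, Real.exp (-r) * c * resUnitDensity F γ K S₀ u ≤ resUnitDensity F γ (K + 1) S₁ u ∧
      resUnitDensity F γ (K + 1) S₁ u ≤ Real.exp r * c * resUnitDensity F γ K S₀ u) :
    IsTilt (Measure.map (unitA F ℰp K) ((gibbsK F ℰp γ K).restrict S₀))
      (Measure.map (unitA F ℰp (K + 1)) ((gibbsK F ℰp γ (K + 1)).restrict S₁)) r := by
  let Z : ℕ → ℝ := fun K =>
    partitionFn (G := Matrix.specialUnitaryGroup (Fin 2) ℂ) (F.P K) ((F.scheme ℰp γ).β K)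
  have hZ : ∀ K, 0 < Z K := fun K => partitionFn_pos' _ (F.scheme_β_nonneg ℰp hγ K)
  rw [map_unitA_restrict_eq_withDensity F K hS₀ hγ, map_unitA_restrict_eq_withDensity F (K + 1) hS₁ hγ]
  refine IsTilt.of_sandwich _ ((resUnitDensity_props F K hS₀ hγ).1.const_mul _)
    ((resUnitDensity_props F (K + 1) hS₁ hγ).1.const_mul _)
    (fun u => mul_nonneg (inv_nonneg.mpr (hZ K).le) (resUnitDensity_nonneg F γ K S₀ u)) hr
    (c := c * Z K / Z (K + 1)) (div_pos (mul_pos hc (hZ K)) (hZ (K + 1))) fun u => ?_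
  obtain ⟨h1, h2⟩ := hsand u
  have hZK : Z K ≠ 0 := (hZ K).ne'
  have hZK1 : 0 < Z (K + 1) := hZ (K + 1)
  constructor
  · show Real.exp (-r) * (c * Z K / Z (K + 1)) * ((Z K)⁻¹ * resUnitDensity F γ K S₀ u) ≤
      (Z (K + 1))⁻¹ * resUnitDensity F γ (K + 1) S₁ u
    have e : Real.exp (-r) * (c * Z K / Z (K + 1)) * ((Z K)⁻¹ * resUnitDensity F γ K S₀ u) =
        (Z (K + 1))⁻¹ * (Real.exp (-r) * c * resUnitDensity F γ K S₀ u) := by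
      field_simp
    rw [e]
    exact mul_le_mul_of_nonneg_left h1 (inv_nonneg.mpr hZK1.le)
  · show (Z (K + 1))⁻¹ * resUnitDensity F γ (K + 1) S₁ u ≤
      Real.exp r * (c * Z K / Z (K + 1)) * ((Z K)⁻¹ * resUnitDensity F γ K S₀ u)
    have e : Real.exp r * (c * Z K / Z (K + 1)) * ((Z K)⁻¹ * resUnitDensity F γ K S₀ u) =
        (Z (K + 1))⁻¹ * (Real.exp r * c * resUnitDensity F γ K S₀ u) := by
      field_simp
    rw [e]
    exact mul_le_mul_of_nonneg_left h2 (inv_nonneg.mpr hZK1.le)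

/-- The same from an ALMOST-EVERYWHERE sandwich (product Haar on `T₁`), the natural form for Radon–Nikodym versions.
[cite: King1986, Thm 3.4 (3.9) p.656] -/
theorem isTilt_restrict_of_sandwich_ae (hS₀ : MeasurableSet S₀) (hS₁ : MeasurableSet S₁) {r c : ℝ} (hr : 0 ≤ r)
    (hc : 0 < c)
    (hsand : ∀ᵐ u ∂fieldMeasure (F.P 0) 0 (Matrix.specialUnitaryGroup (Fin 2) ℂ),
      Real.exp (-r) * c * resUnitDensity F γ K S₀ u ≤ resUnitDensity F γ (K + 1) S₁ u ∧
      resUnitDensity F γ (K + 1) S₁ u ≤ Real.exp r * c * resUnitDensity F γ K S₀ u) :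
    IsTilt (Measure.map (unitA F ℰp K) ((gibbsK F ℰp γ K).restrict S₀))
      (Measure.map (unitA F ℰp (K + 1)) ((gibbsK F ℰp γ (K + 1)).restrict S₁)) r := by
  let Z : ℕ → ℝ := fun K =>
    partitionFn (G := Matrix.specialUnitaryGroup (Fin 2) ℂ) (F.P K) ((F.scheme ℰp γ).β K)
  have hZ : ∀ K, 0 < Z K := fun K => partitionFn_pos' _ (F.scheme_β_nonneg ℰp hγ K)
  rw [map_unitA_restrict_eq_withDensity F K hS₀ hγ, map_unitA_restrict_eq_withDensity F (K + 1) hS₁ hγ]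
  refine isTilt_withDensity_of_sandwich_ae _ ((resUnitDensity_props F K hS₀ hγ).1.const_mul _)
    ((resUnitDensity_props F (K + 1) hS₁ hγ).1.const_mul _)
    (fun u => mul_nonneg (inv_nonneg.mpr (hZ K).le) (resUnitDensity_nonneg F γ K S₀ u))
    (fun u => mul_nonneg (inv_nonneg.mpr (hZ (K + 1)).le) (resUnitDensity_nonneg F γ (K + 1) S₁ u)) hr
    (c := c * Z K / Z (K + 1)) (div_pos (mul_pos hc (hZ K)) (hZ (K + 1))) (hsand.mono fun u hu => ?_)
  obtain ⟨h1, h2⟩ := hu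
  have hZK : Z K ≠ 0 := (hZ K).ne'
  have hZK1 : 0 < Z (K + 1) := hZ (K + 1)
  constructor
  · show Real.exp (-r) * (c * Z K / Z (K + 1)) * ((Z K)⁻¹ * resUnitDensity F γ K S₀ u) ≤
      (Z (K + 1))⁻¹ * resUnitDensity F γ (K + 1) S₁ u
    have e : Real.exp (-r) * (c * Z K / Z (K + 1)) * ((Z K)⁻¹ * resUnitDensity F γ K S₀ u) =
        (Z (K + 1))⁻¹ * (Real.exp (-r) * c * resUnitDensity F γ K S₀ u) := by
      field_simp
    rw [e]
    exact mul_le_mul_of_nonneg_left h1 (inv_nonneg.mpr hZK1.le)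
  · show (Z (K + 1))⁻¹ * resUnitDensity F γ (K + 1) S₁ u ≤
      Real.exp r * (c * Z K / Z (K + 1)) * ((Z K)⁻¹ * resUnitDensity F γ K S₀ u)
    have e : Real.exp r * (c * Z K / Z (K + 1)) * ((Z K)⁻¹ * resUnitDensity F γ K S₀ u) =
        (Z (K + 1))⁻¹ * (Real.exp r * c * resUnitDensity F γ K S₀ u) := by
      field_simp
    rw [e]
    exact mul_le_mul_of_nonneg_left h2 (inv_nonneg.mpr hZK1.le)

end Sandwich

section Route

/-- **THE ROUTE'S K1 BODY FROM SANDWICHES OF RESTRICTED UNIT DENSITIES**: if for every `K` the restricted unit densities of the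
two consecutive approximations on Bałaban's UV-small-history events with `⌊K/m⌋` free top steps satisfy an a.e. two-run sandwich
modulo a free constant `c_K > 0` with radii `r_K ≥ 0`, `Σ r_K < ∞`, then `UnitTiltAt F γ b₀ p₀ m` (`γ ≥ 0`).  This is the form in
which the d = 3 expectations step is to be proved from the (α) inputs: the two runs' RESTRICTED effective densities at the unit
lattice compared with each other, [King1986] Thm 3.4 transplanted; [Balaban1985UV3] (41)/(47) are one-run envelopes of the same
objects. [cite: King1986, Thm 3.4 (3.9)-(3.13) p.656] -/
theorem unitTiltAt_of_sandwich (F : T3Family) {γ : ℝ} (hγ : 0 ≤ γ) (b₀ p₀ : ℝ) (m : ℕ) {r : ℕ → ℝ} (hr : Summable r)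
    (hr0 : ∀ K, 0 ≤ r K) (c : ℕ → ℝ) (hc : ∀ K, 0 < c K)
    (hsand : ∀ K, ∀ᵐ u ∂fieldMeasure (F.P 0) 0 (Matrix.specialUnitaryGroup (Fin 2) ℂ),
      Real.exp (-r K) * c K * resUnitDensity F γ K (histGood F ℰp (θBal F.L γ b₀ p₀) K (K / m)) u ≤
          resUnitDensity F γ (K + 1) (histGood F ℰp (θBal F.L γ b₀ p₀) (K + 1) (K / m)) u ∧
        resUnitDensity F γ (K + 1) (histGood F ℰp (θBal F.L γ b₀ p₀) (K + 1) (K / m)) u ≤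
          Real.exp (r K) * c K * resUnitDensity F γ K (histGood F ℰp (θBal F.L γ b₀ p₀) K (K / m)) u) :
    UnitTiltAt F γ b₀ p₀ m :=
  ⟨r, hr, fun K => isTilt_restrict_of_sandwich_ae F hγ K
    (measurableSet_histGood F ℰp measurableE_ℰp _ K _) (measurableSet_histGood F ℰp measurableE_ℰp _ (K + 1) _)
    (hr0 K) (hc K) (hsand K)⟩

end Route

end Literature.MathematicalPhysics.QuantumFieldTheory.Balaban1983to89.T3RestrictedUnitDensity

end
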